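import Literature.AlgebraicGeometry.Modules.UnitCocycle
import HarnessLib

/-!
# Pull-back of Čech `1`-cocycles of units along a morphism of schemes

Continuation of `Modules/UnitCocycle.lean`: for a morphism of schemes `f : X ⟶ Y`,

* `UnitCocycle.pullback f c` — the pulled-back cocycle `U_x := f⁻¹ U_{f x}`,
  `g_{xy} := f^♯(g_{f x, f y})` (through Mathlib's `Scheme.Hom.appLE`), compatible with coboundaries
  (`pullback_equiv`) and with products (`pullback_mul_equiv`);
* `CechPic.pullback f : CechPic Y →* CechPic X` — the induced group homomorphism
  `f^* : Ȟ¹(Y, 𝒪_Y^×) → Ȟ¹(X, 𝒪_X^×)` (Hartshorne III §4; for line bundles this is `L ↦ f^*L`,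
  II.6 p. 143 / Ex. II.6.8).

Everything is proved; no named facts. Deliberately not here: the functoriality identities
`(𝟙)^* = id`, `(f ≫ g)^* = f^* ∘ g^*` (not needed by the present consumers).

## References

* R. Hartshorne, *Algebraic Geometry*, GTM 52 (1977), III §4, II Ex. 6.8. [Hartshorne1977]
-/

noncomputable section

open CategoryTheory AlgebraicGeometry Opposite TopologicalSpace

namespace Literature.AlgebraicGeometry.Modules

universe u

variable {X Y : Scheme.{u}}

/-! ### Pull-back along a morphism of schemes -/

namespace UnitCocycle

variable (f : X ⟶ Y)

/-- The preimage of an intersection of opens is the intersection of the preimages (as an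
inequality, to feed `Scheme.Hom.appLE`). [folklore] -/
lemma le_preimage_inf {V : X.Opens} {U U' : Y.Opens} (h : V ≤ f ⁻¹ᵁ U) (h' : V ≤ f ⁻¹ᵁ U') :
    V ≤ f ⁻¹ᵁ (U ⊓ U') :=
  fun _ hv => ⟨h hv, h' hv⟩

/-- **Pull-back of a cocycle** along `f : X ⟶ Y`: `U_x := f⁻¹ U_{f x}` and
`g_{xy} := f^♯(g_{f x, f y})` (via `Scheme.Hom.appLE`). [folklore] -/
def pullback (c : UnitCocycle Y) : UnitCocycle X where
  U x := f ⁻¹ᵁ c.U (f.base x)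
  mem x := c.mem (f.base x)
  g x y V hx hy := f.appLE (c.U (f.base x) ⊓ c.U (f.base y)) V (le_preimage_inf f hx hy)
    (c.g (f.base x) (f.base y) _ inf_le_left inf_le_right)
  map_g x y V V' hx hy i := by
    change (f.appLE _ V _ ≫ X.presheaf.map (homOfLE i).op) _ = _
    rw [Scheme.Hom.appLE_map]
  g_mul x y z V hx hy hz := by
    -- move the three transition functions to `U_{fx} ⊓ U_{fy} ⊓ U_{fz}`
    have e₃ : V ≤ f ⁻¹ᵁ (c.U (f.base x) ⊓ c.U (f.base y) ⊓ c.U (f.base z)) :=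
      le_preimage_inf f (le_preimage_inf f hx hy) hz
    have key : ∀ {U' : Y.Opens} (i : c.U (f.base x) ⊓ c.U (f.base y) ⊓ c.U (f.base z) ≤ U')
        (e : V ≤ f ⁻¹ᵁ U') (s : Γ(Y, U')),
        f.appLE U' V e s = f.appLE _ V e₃ (secRes Y i s) := by
      intro U' i e s
      change _ = (Y.presheaf.map (homOfLE i).op ≫ f.appLE _ V e₃) s
      rw [Scheme.Hom.map_appLE]
    rw [key (inf_le_left : _ ≤ c.U (f.base x) ⊓ c.U (f.base y)),
      key (le_inf (inf_le_left.trans inf_le_right) inf_le_right :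
        _ ≤ c.U (f.base y) ⊓ c.U (f.base z)),
      key (le_inf (inf_le_left.trans inf_le_left) inf_le_right :
        _ ≤ c.U (f.base x) ⊓ c.U (f.base z)),
      ← map_mul, c.map_g, c.map_g, c.map_g, c.g_mul]
  g_self x V hx := by
    rw [c.g_self, map_one]

/-- Pull-back of cocycles is compatible with equivalence. [folklore] -/
lemma pullback_equiv {c c' : UnitCocycle Y} (h : Equiv c c') :
    Equiv (pullback f c) (pullback f c') := by
  obtain ⟨b⟩ := h
  refine ⟨{
    W := fun x => f ⁻¹ᵁ b.W (f.base x)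
    mem := fun x => b.mem (f.base x)
    le := fun x => (Opens.map f.base).map (homOfLE (b.le (f.base x))) |>.le
    le' := fun x => (Opens.map f.base).map (homOfLE (b.le' (f.base x))) |>.le
    lam := fun x V h => f.appLE (b.W (f.base x)) V h (b.lam (f.base x) _ le_rfl)
    inv := fun x V h => f.appLE (b.W (f.base x)) V h (b.inv (f.base x) _ le_rfl)
    map_lam := fun x V V' h i => by
      change (f.appLE _ V _ ≫ X.presheaf.map (homOfLE i).op) _ = _
      rw [Scheme.Hom.appLE_map]
    lam_mul_inv := fun x V h => by rw [← map_mul, b.lam_mul_inv, map_one]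
    rel := fun x y V hx hy => ?_ }⟩
  -- move everything to `W_{fx} ⊓ W_{fy}`
  have e₂ : V ≤ f ⁻¹ᵁ (b.W (f.base x) ⊓ b.W (f.base y)) := le_preimage_inf f hx hy
  have key : ∀ {U' : Y.Opens} (i : b.W (f.base x) ⊓ b.W (f.base y) ≤ U') (e : V ≤ f ⁻¹ᵁ U')
      (s : Γ(Y, U')), f.appLE U' V e s = f.appLE _ V e₂ (secRes Y i s) := by
    intro U' i e s
    change _ = (Y.presheaf.map (homOfLE i).op ≫ f.appLE _ V e₂) s
    rw [Scheme.Hom.map_appLE]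
  change f.appLE _ V _ (c'.g _ _ _ _ _) * f.appLE _ V _ _ = f.appLE _ V _ _ * f.appLE _ V _ (c.g _ _ _ _ _)
  rw [key (inf_le_inf (b.le' (f.base x)) (b.le' (f.base y))), key (inf_le_right : _ ≤ b.W (f.base y)),
    key (inf_le_left : _ ≤ b.W (f.base x)), key (inf_le_inf (b.le (f.base x)) (b.le (f.base y))),
    ← map_mul, ← map_mul, c'.map_g, c.map_g, b.map_lam, b.map_lam, b.rel]

/-- Pull-back commutes with the product of cocycles, up to equivalence (the two sides live on the
covers `f⁻¹(U_{fx} ⊓ U'_{fx})` and `f⁻¹U_{fx} ⊓ f⁻¹U'_{fx}`, which agree). [folklore] -/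
lemma pullback_mul_equiv (c c' : UnitCocycle Y) :
    Equiv (pullback f (mul c c')) (mul (pullback f c) (pullback f c')) := by
  refine equiv_of_eq _ _ (fun x => f ⁻¹ᵁ (c.U (f.base x) ⊓ c'.U (f.base x)))
    (fun x => ⟨c.mem (f.base x), c'.mem (f.base x)⟩) (fun x => le_rfl) (fun x => le_rfl) ?_
  intro x y V hx hy
  have e₄ : V ≤ f ⁻¹ᵁ (c.U (f.base x) ⊓ c'.U (f.base x) ⊓ (c.U (f.base y) ⊓ c'.U (f.base y))) :=
    le_preimage_inf f hx hy
  have key : ∀ {U' : Y.Opens}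
      (i : c.U (f.base x) ⊓ c'.U (f.base x) ⊓ (c.U (f.base y) ⊓ c'.U (f.base y)) ≤ U')
      (e : V ≤ f ⁻¹ᵁ U') (s : Γ(Y, U')), f.appLE U' V e s = f.appLE _ V e₄ (secRes Y i s) := by
    intro U' i e s
    change _ = (Y.presheaf.map (homOfLE i).op ≫ f.appLE _ V e₄) s
    rw [Scheme.Hom.map_appLE]
  change f.appLE _ V _ (c.g _ _ _ _ _) * f.appLE _ V _ (c'.g _ _ _ _ _) =
    f.appLE (c.U (f.base x) ⊓ c'.U (f.base x) ⊓ (c.U (f.base y) ⊓ c'.U (f.base y))) V e₄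
      (c.g _ _ _ _ _ * c'.g _ _ _ _ _)
  rw [key (inf_le_inf inf_le_left inf_le_left), key (inf_le_inf inf_le_right inf_le_right),
    ← map_mul, c.map_g, c'.map_g]
  rfl

end UnitCocycle

namespace CechPic

variable (f : X ⟶ Y)

/-- **Pull-back `f^* : Ȟ¹(Y, 𝒪_Y^×) → Ȟ¹(X, 𝒪_X^×)`** along a morphism of schemes, a group
homomorphism. [folklore] -/
def pullback : CechPic Y →* CechPic X where
  toFun := Quotient.map (UnitCocycle.pullback f) (fun _ _ h => UnitCocycle.pullback_equiv f h)
  map_one' := by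
    change mk (UnitCocycle.pullback f (UnitCocycle.one Y)) = mk (UnitCocycle.one X)
    refine sound (UnitCocycle.equiv_of_eq _ _ (fun _ => ⊤) (fun _ => trivial) (fun _ => le_top)
      (fun _ => le_top) fun x y V hx hy => ?_)
    exact (map_one (f.appLE _ V _).hom).symm
  map_mul' := by
    rintro ⟨c⟩ ⟨c'⟩
    exact sound (UnitCocycle.pullback_mul_equiv f c c')

/-- The pull-back of the class of a cocycle is the class of the pulled-back cocycle. [folklore] -/
lemma pullback_mk (c : UnitCocycle Y) : pullback f (mk c) = mk (UnitCocycle.pullback f c) := rfl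

end CechPic

end Literature.AlgebraicGeometry.Modules

end
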